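import Literature.NumberTheory.ComplexMultiplication.EllipticUnits.KatoEllipticZetaElement
import Literature.NumberTheory.EllipticCurves.Kato2004.ZetaQuotientPackageCoeff
import HarnessLib

/-!
# Sketch — stub-ideation k = 2, generation 3 («no-defect descent of the CM equality to the cyclotomic line at 2»)
# for the registered stub `stub_cmLambdaLower` (S2 = route item `ResidualSignedLambdaLowerCMAtTwo`, stmt-…-22608)
# of `Cruxes/ResidualThetaCountLowerPureAtTwo/Lines/bt26_lambda.lean` (v6)

Scratch file of seat `planner-sidea-stub_cmLambdaLower-2-g3-0`. It TYPES, over existing declarations, the helper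
lemmas of the gen-3 idea card `Ideas/stub-cmlambdalower-k2.md` — the in-tree DERIVATION of the one printed input of
S2 that is specific to CM at the inert prime `2`, namely DAG node N4 / HOLD clause KZ_g(ii)

  «`ℓ_𝔭(𝐇¹(T_g)/Z) = ℓ_𝔭(𝐇²(T_g))` at every height-one prime `𝔭 ∌ ϖ` of `Λ_𝒪`» (Burungale–Tian 2026 Thm. 2.6 ⊗ ℚ),

from: Johnson-Leung–Kings 2011 §7.2 (tree predicate `ZetaSkeleton.Thm57RegularShape`, Kato-tower form
`EllipticUnitTower.thm57RegularShape_lengthAt_atPrime_eq_of_not_mem`) + Kato 2004 §15.1 (tree `Section151Shape`)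
+ Kato Lemma 15.13 (shape typed below, §3) + Kato Lemma 14.15 (numerical form, §1) + the NO-DEFECT LEMMA (§2, new;
one variable up from the tree theorem `Kato2004.invariants_quotient_span_eq_bot`):
the one step that Kato's Prop. 15.17 (which proves only `≤`) discards and that Burungale–Tian's footnote 4 leaves
implicit.  §4 proves, sorry-free, the length bookkeeping that turns these inputs into the equality on the line, and
the fact that S2 consumes only ONE direction of it (the one opposite to Kato's Euler-system divisibility).
§5 types the one-sided weakening of the tree's HOLD predicate `ZetaQuotientPackage.CharIdealEqUpToConst`.

Named `def … : Prop` items are SIGNATURES (helper lemmas to prove; nothing is asserted); `theorem`s are proved.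
The stub is NOT proved; S2 / items 26074, 22608 stay OPEN; BSD is NOT proved by any of this.
-/

set_option autoImplicit false
set_option linter.dupNamespace false

noncomputable section

open scoped Classical

namespace Summit.BirchSwinnertonDyer.BirchSwinnertonDyer.Cruxes.ResidualThetaCountLowerPureAtTwo.StubIdeasK2G3

open Literature.NumberTheory.EllipticCurves

universe u

/-! ## §0 Two numbers attached to multiplication by `a` on an `A`-module (Kato's `[M/aM]` and `[ₐM]`, p. 244) -/

/-- `ℓ_A(M/aM)` (Kato Lemma 14.15's `[M/aM]`, read through `Module.length`). -/
def modLength (A : Type u) [CommRing A] (a : A) (M : Type u) [AddCommGroup M] [Module A M] : ℕ∞ :=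
  Module.length A (M ⧸ (Ideal.span {a} • (⊤ : Submodule A M)))

/-- `ℓ_A(ₐM)`, `ₐM = Ker(a : M → M)` (Kato Lemma 14.15's `[ₐM]`). -/
def kerLength (A : Type u) [CommRing A] (a : A) (M : Type u) [AddCommGroup M] [Module A M] : ℕ∞ :=
  Module.length A (Submodule.torsionBy A M a)

/-! ## §1 H1 — Kato Lemma 14.15 in numerical form over a two-dimensional Noetherian local domain
(Astérisque 295, pp. 243–244; cited as "Lemma 14.12" in the proof of Prop. 15.17, p. 265).  Over `A` local of
dimension `2` the category `C` of loc. cit. is the finite-length modules and `G(C) = ℤ` by `length`, so the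
identity in `G(C)` becomes an identity of lengths. -/

/-- **H1 (Kato L.14.15, numerical).**  `A` Noetherian local domain of Krull dimension `2`, `M` f.g. torsion,
`a ∈ A` outside every height-one prime of the support of `M`:
`ℓ(M/aM) = ℓ(ₐM) + Σ_{𝔮 ht 1, a ∉ 𝔮} ℓ_{A_𝔮}(M_𝔮) · ℓ_A(A/(𝔮 + aA))` (all terms finite). -/
def KatoLemma1415Numerical : Prop :=
  ∀ (A : Type u) [CommRing A] [IsDomain A] [IsNoetherianRing A] [IsLocalRing A],
    ringKrullDim A = 2 →
    ∀ (a : A) (M : Type u) [AddCommGroup M] [Module A M] [Module.Finite A M],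
      Module.IsTorsion A M →
      (∀ 𝔮 : PrimeSpectrum A, 𝔮.asIdeal.height = 1 → a ∈ 𝔮.asIdeal → Module.lengthAt A M 𝔮 = 0) →
      modLength A a M =
        kerLength A a M +
          ∑ᶠ 𝔮 ∈ {𝔮 : PrimeSpectrum A | 𝔮.asIdeal.height = 1 ∧ a ∉ 𝔮.asIdeal},
            Module.lengthAt A M 𝔮 * Module.length A (A ⧸ (𝔮.asIdeal ⊔ Ideal.span {a}))

/-- **H1′ (the corollary actually consumed): the Euler characteristic `ℓ(M/aM) − ℓ(ₐM)` depends only on the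
lengths of `M` at the height-one primes.**  Written cross-added (no subtraction in `ℕ∞`). -/
def EulerCharEqOfLengthAtEq : Prop :=
  ∀ (A : Type u) [CommRing A] [IsDomain A] [IsNoetherianRing A] [IsLocalRing A],
    ringKrullDim A = 2 →
    ∀ (a : A) (M N : Type u) [AddCommGroup M] [Module A M] [Module.Finite A M]
      [AddCommGroup N] [Module A N] [Module.Finite A N],
      Module.IsTorsion A M → Module.IsTorsion A N →
      (∀ 𝔮 : PrimeSpectrum A, 𝔮.asIdeal.height = 1 → Module.lengthAt A M 𝔮 = Module.lengthAt A N 𝔮) →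
      modLength A a N ≠ ⊤ →
      modLength A a M + kerLength A a N = modLength A a N + kerLength A a M

/-! ## §2 H2 — the NO-DEFECT LEMMA (new here; pure commutative algebra, ONE VARIABLE UP from the tree theorem
`Kato2004.invariants_quotient_span_eq_bot` of `Kato2004/MainConjectureDescentSkeletonProofs.lean`, which is the case
`A = ℤ_p⟦T⟧`, `a = T`).  In the application `A = O_λ[[G_{2^∞𝔣}]]_𝔮` (a two-dimensional regular local ring, Kato
L.15.13 (1) at `𝔮 ∌ 2`), `a` generates the prime `Ker(A → O_λ[[G_∞]]_𝔭)` with `A/aA` a DVR (so `(a)` is prime and NOT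
maximal), `M = H¹_{2^∞𝔣}(T)_𝔮` is torsion-free (Kato §15.1 / Thm. 12.4 (3); tree `Section151Shape`, twist-invariant),
`z` = the elliptic zeta element (`≠ 0`), and the finiteness hypothesis comes from H2b. Proof sketch (as in Kato 13.8):
`M[a] = 0`, so the snake lemma embeds `(M/Az)[a]` into `Az/aAz ≅ A/aA`, a domain of dimension `≥ 1`, which has no
non-zero submodule of finite length: if `a·x = λz` and `s·x = κz` with `s ∈ 𝔪^k ∖ (a)` killing `(M/Az)[a]`, then
`sλ = aκ`, `a ∣ λ`, `x ∈ Az`. -/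

/-- **H2 (no defect).**  `Ker(a : M/Az → M/Az) = 0` for `M` torsion-free over a Noetherian local domain `A`, `z ≠ 0`,
`(a)` a non-zero prime that is not maximal, and `(M/Az)[a]` of finite length — the term Kato's Prop. 15.17 drops. -/
def NoDefect : Prop :=
  ∀ (A : Type u) [CommRing A] [IsDomain A] [IsNoetherianRing A] [IsLocalRing A] (a : A),
    a ≠ 0 → (Ideal.span {a}).IsPrime → ¬ (Ideal.span {a}).IsMaximal →
    ∀ (M : Type u) [AddCommGroup M] [Module A M] [NoZeroSMulDivisors A M] (z : M), z ≠ 0 →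
      kerLength A a (M ⧸ Submodule.span A {z}) ≠ ⊤ →
      Submodule.torsionBy A (M ⧸ Submodule.span A {z}) a = ⊥

/-- **H2b (where the finiteness in H2 comes from).**  Over a Noetherian local domain of dimension `2`, a f.g.
TORSION module `N` with `N/aN` of finite length has `ₐN` of finite length (Nakayama: `a` lies in no height-one prime
of `Supp N`, so `Supp(ₐN) ⊆ Supp N ∩ V(a) = {𝔪}`).  Applied to `N = M/Az` (torsion: Kato §15.1 "`𝔥¹/ℨ` is torsion"),
whose `N/aN` embeds by (15.13.2) into `𝐇¹(T~)_𝔭/z~`, of finite length by Kato Thm. 12.4 (2) + 12.5 (2). -/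
def KerLengthFiniteOfModLengthFinite : Prop :=
  ∀ (A : Type u) [CommRing A] [IsDomain A] [IsNoetherianRing A] [IsLocalRing A],
    ringKrullDim A = 2 →
    ∀ (a : A) (N : Type u) [AddCommGroup N] [Module A N] [Module.Finite A N],
      Module.IsTorsion A N → modLength A a N ≠ ⊤ → kerLength A a N ≠ ⊤

/-! ## §3 H3 — the shape of Kato's base-change Lemma 15.13 (p. 264) at a height-one prime `𝔭 ∌ 2` of
`O_λ[[G_∞]]`, `𝔮 ⊂ O_λ[[G_{2^∞𝔣}]]` its inverse image, `A = O_λ[[G_{2^∞𝔣}]]_𝔮`, `a` a generator of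
`Ker(A → O_λ[[G_∞]]_𝔭)`:  (15.13.1) `H²_𝔮/aH²_𝔮 ≅ 𝐇²(T~)_𝔭`;  (15.13.2) `0 → H¹_𝔮/aH¹_𝔮 → 𝐇¹(T~)_𝔭 → ₐ(H²_𝔮) → 0`,
the zeta element upstairs mapping to the zeta element downstairs ((15.16.1)).  Its hypotheses — "`p·#Δ`
invertible in `κ(𝔭)`" and "`K ⊄` the cyclotomic `ℤ_p`-tower" — are AUTOMATIC here: `𝔭 ∌ 2`, and `Odd M` with
`a₂(g) = 0` forces `2` inert in `K`, so `K ∉ {ℚ(i), ℚ(√−2)}`.  Typed over abstract carriers; nothing asserted. -/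

/-- **H3 (Kato L.15.13 shape).** The `ℚ`-side modules `H1Q, H2Q` are `A`-modules killed by `a`
(modules over `B = A/aA = O_λ[[G_∞]]_𝔭`, a DVR). -/
def Lemma1513Shape (A : Type u) [CommRing A] (a : A)
    (H1K H2K H1Q H2Q : Type u) [AddCommGroup H1K] [Module A H1K] [AddCommGroup H2K] [Module A H2K]
    [AddCommGroup H1Q] [Module A H1Q] [AddCommGroup H2Q] [Module A H2Q] (zK : H1K) (zQ : H1Q) : Prop :=
  ∃ (_e₂ : (H2K ⧸ (Ideal.span {a} • (⊤ : Submodule A H2K))) ≃ₗ[A] H2Q)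
    (ι : (H1K ⧸ (Ideal.span {a} • (⊤ : Submodule A H1K))) →ₗ[A] H1Q)
    (π : H1Q →ₗ[A] Submodule.torsionBy A H2K a),
    Function.Injective ι ∧ Function.Surjective π ∧ Function.Exact ι π ∧
      ι (Submodule.Quotient.mk zK) = zQ

/-- **The target of Plan A (replaces the cyclotomic-line half of the port of BT26 Thm. 2.6):**
from the `K`-side data at `𝔮` — `H¹_𝔮` torsion-free with `H¹_𝔮/Az` f.g. torsion (Kato §15.1, tree `Section151Shape`
localised), `H²_𝔮` f.g. torsion, the JLK §7.2 length equality at the height-one primes of `A`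
(`EllipticUnitTower.thm57RegularShape_lengthAt_atPrime_eq_of_not_mem`), `(a)` a non-zero non-maximal prime of the
two-dimensional Noetherian local domain `A` (Kato L.15.13 (1)) — the Lemma-15.13 bridge, and the finiteness of
`𝐇²(T~)_𝔭` and `𝐇¹(T~)_𝔭/z~` (Kato Thm. 12.4 + 12.5 (2) at the height-one prime `𝔭`): the EQUALITY of lengths on the
line.  Kernel proof = H1′ + H2 + H2b + the bookkeeping of §4 (`line_equality_of_noDefect`). -/
def LineLengthEqOfRegularPrimes : Prop :=
  ∀ (A : Type u) [CommRing A] [IsDomain A] [IsNoetherianRing A] [IsLocalRing A],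
    ringKrullDim A = 2 →
    ∀ (a : A), a ≠ 0 → (Ideal.span {a}).IsPrime → ¬ (Ideal.span {a}).IsMaximal →
    ∀ (H1K H2K H1Q H2Q : Type u) [AddCommGroup H1K] [Module A H1K] [Module.Finite A H1K]
      [NoZeroSMulDivisors A H1K] [AddCommGroup H2K] [Module A H2K] [Module.Finite A H2K]
      [AddCommGroup H1Q] [Module A H1Q] [AddCommGroup H2Q] [Module A H2Q] (zK : H1K) (zQ : H1Q),
      zK ≠ 0 → Module.IsTorsion A (H1K ⧸ Submodule.span A {zK}) → Module.IsTorsion A H2K →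
      (∀ 𝔮 : PrimeSpectrum A, 𝔮.asIdeal.height = 1 →
        Module.lengthAt A (H1K ⧸ Submodule.span A {zK}) 𝔮 = Module.lengthAt A H2K 𝔮) →
      Lemma1513Shape A a H1K H2K H1Q H2Q zK zQ →
      Module.length A H2Q ≠ ⊤ → Module.length A (H1Q ⧸ Submodule.span A {zQ}) ≠ ⊤ →
      Module.length A (H1Q ⧸ Submodule.span A {zQ}) = Module.length A H2Q

/-- **One-sided variant (what S2 actually consumes: `ℓ(𝐇¹(T~)_𝔭/z~) ≤ ℓ(𝐇²(T~)_𝔭)`).**  Same hypotheses; recorded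
separately because it is the direction OPPOSITE to Kato's Prop. 15.17 and is NOT implied by Rubin's Thm. 15.2. -/
def LineLengthLeOfRegularPrimes : Prop :=
  ∀ (A : Type u) [CommRing A] [IsDomain A] [IsNoetherianRing A] [IsLocalRing A],
    ringKrullDim A = 2 →
    ∀ (a : A), a ≠ 0 → (Ideal.span {a}).IsPrime → ¬ (Ideal.span {a}).IsMaximal →
    ∀ (H1K H2K H1Q H2Q : Type u) [AddCommGroup H1K] [Module A H1K] [Module.Finite A H1K]
      [NoZeroSMulDivisors A H1K] [AddCommGroup H2K] [Module A H2K] [Module.Finite A H2K]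
      [AddCommGroup H1Q] [Module A H1Q] [AddCommGroup H2Q] [Module A H2Q] (zK : H1K) (zQ : H1Q),
      zK ≠ 0 → Module.IsTorsion A (H1K ⧸ Submodule.span A {zK}) → Module.IsTorsion A H2K →
      (∀ 𝔮 : PrimeSpectrum A, 𝔮.asIdeal.height = 1 →
        Module.lengthAt A (H1K ⧸ Submodule.span A {zK}) 𝔮 = Module.lengthAt A H2K 𝔮) →
      Lemma1513Shape A a H1K H2K H1Q H2Q zK zQ →
      Module.length A H2Q ≠ ⊤ → Module.length A (H1Q ⧸ Submodule.span A {zQ}) ≠ ⊤ →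
      Module.length A (H1Q ⧸ Submodule.span A {zQ}) ≤ Module.length A H2Q

/-! ## §4 PROVED: the bookkeeping.  With `m₁ = ℓ(M₁/aM₁)`, `k₁ = ℓ(ₐM₁)` for `M₁ = H¹_𝔮/Az`, `m₂, k₂` for
`M₂ = H²_𝔮`, (15.13.1) gives `ℓ(𝐇²(T~)_𝔭) = m₂`, (15.13.2) modulo the zeta line gives
`ℓ(𝐇¹(T~)_𝔭/z~) = m₁ + k₂`, JLK + H1′ give `m₁ + k₂ = m₂ + k₁`.  Hence the DEFECT FORMULA
`ℓ(𝐇¹(T~)_𝔭/z~) = ℓ(𝐇²(T~)_𝔭) + k₁`: Kato's inequality is `k₁ ≥ 0`, the equality is EXACTLY `k₁ = 0` (H2). -/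

/-- Defect formula on the line. -/
theorem line_defect_formula {q₁ q₂ m₁ k₁ m₂ k₂ : ℕ∞}
    (hq₁ : q₁ = m₁ + k₂) (hq₂ : q₂ = m₂) (hEC : m₁ + k₂ = m₂ + k₁) :
    q₁ = q₂ + k₁ := by
  rw [hq₁, hEC, hq₂]

/-- Kato's direction (Prop. 15.17: `ℓ(𝐇²(T~)_𝔭) ≤ ℓ(𝐇¹(T~)_𝔭/z~)`) needs no information on `k₁`. -/
theorem line_kato_direction {q₁ q₂ m₁ k₁ m₂ k₂ : ℕ∞}
    (hq₁ : q₁ = m₁ + k₂) (hq₂ : q₂ = m₂) (hEC : m₁ + k₂ = m₂ + k₁) :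
    q₂ ≤ q₁ := by
  rw [line_defect_formula hq₁ hq₂ hEC]
  exact le_self_add

/-- The converse direction — the one S2 consumes (`λ(𝐇¹/Z) ≤ λ(𝐇²)`, a LOWER bound for `λ(X⁺)`) — and hence the
equality, follow exactly when the defect `k₁ = ℓ(ₐ(H¹_𝔮/Az))` vanishes (H2). -/
theorem line_equality_of_noDefect {q₁ q₂ m₁ k₁ m₂ k₂ : ℕ∞}
    (hq₁ : q₁ = m₁ + k₂) (hq₂ : q₂ = m₂) (hEC : m₁ + k₂ = m₂ + k₁) (hnd : k₁ = 0) :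
    q₁ = q₂ := by
  rw [line_defect_formula hq₁ hq₂ hEC, hnd, add_zero]

/-- Conversely, for finite `q₂` the equality FORCES the defect to vanish: the no-defect lemma is not a
convenience but the exact content of the converse direction. -/
theorem noDefect_of_line_equality {q₁ q₂ m₁ k₁ m₂ k₂ : ℕ∞}
    (hq₁ : q₁ = m₁ + k₂) (hq₂ : q₂ = m₂) (hEC : m₁ + k₂ = m₂ + k₁) (hfin : q₂ ≠ ⊤) (heq : q₁ = q₂) :
    k₁ = 0 := by
  have h := line_defect_formula hq₁ hq₂ hEC
  rw [heq] at h
  lift q₂ to ℕ using hfin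
  induction k₁ using ENat.recTopCoe with
  | top => simp at h
  | coe m =>
    norm_cast at h
    have hm : m = 0 := by omega
    simp [hm]

/-- `IsSMulRegular` on a module is the vanishing of `ₐM` (the form in which H2 feeds `k₁ = 0`). -/
theorem torsionBy_eq_bot_of_isSMulRegular {A : Type u} [CommRing A] {M : Type u} [AddCommGroup M]
    [Module A M] {a : A} (h : IsSMulRegular M a) : Submodule.torsionBy A M a = ⊥ := by
  rw [eq_bot_iff]
  intro x hx
  rw [Submodule.mem_torsionBy_iff] at hx
  rw [Submodule.mem_bot]
  exact h (show a • x = a • (0 : M) by rw [hx, smul_zero])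

theorem kerLength_eq_zero_of_isSMulRegular {A : Type u} [CommRing A] {M : Type u} [AddCommGroup M]
    [Module A M] {a : A} (h : IsSMulRegular M a) : kerLength A a M = 0 := by
  rw [kerLength, torsionBy_eq_bot_of_isSMulRegular h]
  exact Module.length_bot

/-! ### PROVED: the algebraic core of H2 (Kato's "argument as in 13.8", one variable up).
What remains of H2 after this theorem is only H2c: a finite-length module over a Noetherian local ring is killed
by some `s ∈ 𝔪^k`, and `𝔪^k ⊄ (a)` because `(a)` is a non-maximal prime. -/

/-- **Core of the no-defect lemma.** `M` torsion-free over a domain, `z ≠ 0`, `(a)` a non-zero prime, and some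
`s ∉ (a)` killing `(M/Az)[a]`: then `(M/Az)[a] = 0`.  (If `a·x = λz` and `s·x = κz` then `sλ = aκ`, so `a ∣ λ`
by primality, `λ = λ'a`, `a·(x − λ'z) = 0`, `x = λ'z ∈ Az`.) -/
theorem torsionBy_quotient_span_eq_bot_of_killed {A : Type u} [CommRing A] [IsDomain A] {a s : A}
    (ha : a ≠ 0) (hprime : (Ideal.span {a}).IsPrime) (hs : s ∉ Ideal.span {a})
    {M : Type u} [AddCommGroup M] [Module A M] [NoZeroSMulDivisors A M] {z : M} (hz : z ≠ 0)
    (hkill : ∀ q ∈ Submodule.torsionBy A (M ⧸ Submodule.span A {z}) a, s • q = 0) :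
    Submodule.torsionBy A (M ⧸ Submodule.span A {z}) a = ⊥ := by
  rw [eq_bot_iff]
  intro q hq
  rw [Submodule.mem_bot]
  have hsq : s • q = 0 := hkill q hq
  rw [Submodule.mem_torsionBy_iff] at hq
  induction q using Submodule.Quotient.induction_on with
  | H x =>
    have hax : a • x ∈ Submodule.span A {z} := by
      rw [← Submodule.Quotient.mk_eq_zero, Submodule.Quotient.mk_smul]; exact hq
    have hsx : s • x ∈ Submodule.span A {z} := by
      rw [← Submodule.Quotient.mk_eq_zero, Submodule.Quotient.mk_smul]; exact hsq
    obtain ⟨lam, hlam⟩ := Submodule.mem_span_singleton.mp hax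
    obtain ⟨kap, hkap⟩ := Submodule.mem_span_singleton.mp hsx
    -- `s·lam = a·kap` in `A`
    have hrel : s * lam = a * kap := by
      have h : (s * lam - a * kap) • z = 0 := by
        rw [sub_smul, mul_smul, hlam, mul_smul, hkap, smul_comm, sub_self]
      rcases smul_eq_zero.mp h with h0 | h0
      · exact sub_eq_zero.mp h0
      · exact absurd h0 hz
    -- primality of `(a)`: `a ∣ lam`
    have hlam_mem : lam ∈ Ideal.span {a} := by
      have hmem : s * lam ∈ Ideal.span {a} := by
        rw [hrel]; exact Ideal.mul_mem_right _ _ (Ideal.mem_span_singleton_self a)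
      rcases hprime.mem_or_mem hmem with h | h
      · exact absurd h hs
      · exact h
    obtain ⟨lam', hlam'⟩ := Ideal.mem_span_singleton'.mp hlam_mem
    -- `a·(x - lam'·z) = 0`, hence `x = lam'·z`
    have h0 : a • (x - lam' • z) = 0 := by
      rw [smul_sub, ← hlam, ← hlam', mul_comm, mul_smul, sub_self]
    rcases smul_eq_zero.mp h0 with h1 | h1
    · exact absurd h1 ha
    · rw [sub_eq_zero] at h1
      rw [h1, Submodule.Quotient.mk_eq_zero]
      exact Submodule.smul_mem _ _ (Submodule.mem_span_singleton_self z)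

/-- **H2c (the remaining, routine half of H2).**  Over a Noetherian local ring, a module of finite length is killed
by an element outside any given non-maximal prime `(a)` (take `s ∈ 𝔪^k ∖ (a)` with `𝔪^k` annihilating it). -/
def ExistsKillerOutside : Prop :=
  ∀ (A : Type u) [CommRing A] [IsNoetherianRing A] [IsLocalRing A] (a : A),
    (Ideal.span {a}).IsPrime → ¬ (Ideal.span {a}).IsMaximal →
    ∀ (Q : Type u) [AddCommGroup Q] [Module A Q], Module.length A Q ≠ ⊤ →
      ∃ s : A, s ∉ Ideal.span {a} ∧ ∀ q : Q, s • q = 0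

/-- H2 follows from its proved core and H2c. -/
theorem noDefect_of_existsKillerOutside (h : ExistsKillerOutside.{u}) : NoDefect.{u} := by
  intro A _ _ _ _ a ha hprime hmax M _ _ _ z hz hfin
  obtain ⟨s, hs, hkill⟩ := h A a hprime hmax (Submodule.torsionBy A (M ⧸ Submodule.span A {z}) a) hfin
  exact torsionBy_quotient_span_eq_bot_of_killed ha hprime hs hz (fun q hq ↦ by
    have := hkill ⟨q, hq⟩
    simpa using this)

/-! ## §5 Plan C — the ONE-SIDED HOLD clause.  S2 uses only `char(𝐇¹_Γ/Z) ∣ const · char(𝐇²_Γ)`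
(i.e. `λ(𝐇¹/Z) ≤ λ(𝐇²)`); the tree's `CharIdealEqUpToConst` is two-sided.  The weakening, and that it IS weaker. -/

section OneSided

open Literature.NumberTheory.GaloisRepresentations Literature.NumberTheory.EllipticCurves.Kato2004

variable {R : Type} [CommRing R] [TopologicalSpace R] {V : Type} [AddCommGroup V] [Module R V]
  [TopologicalSpace V] [IsTopologicalAddGroup V] [ContinuousSMul R V]
  {T : GaloisRep ℚ R V} {p : ℕ} [Fact p.Prime] {κ : ZpExtension ℚ p} {γ : Field.absoluteGaloisGroup ℚ}
  {I : IwasawaH1DataCoeff T p κ γ}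

/-- **KZ_g(ii)≥ — the direction S2 consumes**: `(c)·char(𝐇²_Γ) ⊆ (d)·char(𝐇¹_Γ/Z)` for some non-zero constants,
i.e. `char(𝐇¹_Γ/Z)` divides `char(𝐇²_Γ)` in `Λ ⊗ ℚ` (the elliptic-unit half; OPPOSITE to Kato 12.5 (4)). -/
def CharIdealLeUpToConst (K : ZetaQuotientPackage I) : Prop :=
  ∃ c d : R, c ≠ 0 ∧ d ≠ 0 ∧
    Ideal.span {PowerSeries.C c} * K.charH2 ≤ Ideal.span {PowerSeries.C d} * K.charZetaQuotient

/-- The two-sided tree predicate implies the one-sided clause. -/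
theorem charIdealLeUpToConst_of_eq (K : ZetaQuotientPackage I) (h : K.CharIdealEqUpToConst) :
    CharIdealLeUpToConst K := by
  obtain ⟨c, d, hc, hd, hcd⟩ := h.exists_const_mul_eq
  exact ⟨c, d, hc, hd, hcd.le⟩

end OneSided

/-! ## §6 Plan B — the `Λ`-side source: `Thm52CharShape ⇒ Thm57RegularShape` on one skeleton, via
"equal characteristic ideals ⇒ equal lengths at every height-one prime" over a Noetherian domain. -/

/-- **B1.** For f.g. torsion modules over a Noetherian domain whose height-one supports are finite, equality of the
tree's `Module.charIdeal` gives equality of `Module.lengthAt` at every height-one prime (localise the finite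
product at `𝔮`: the other factors become units, and `𝔮^m A_𝔮 = 𝔮^n A_𝔮 ⇒ m = n` by Nakayama). -/
def LengthAtEqOfCharIdealEq : Prop :=
  ∀ (Λ : Type u) [CommRing Λ] [IsDomain Λ] [IsNoetherianRing Λ]
    (M N : Type u) [AddCommGroup M] [Module Λ M] [Module.Finite Λ M] [AddCommGroup N] [Module Λ N]
    [Module.Finite Λ N],
    Module.IsTorsion Λ M → Module.IsTorsion Λ N →
    (Module.heightOneSupport Λ M).Finite → (Module.heightOneSupport Λ N).Finite →
    Module.charIdeal Λ M = Module.charIdeal Λ N →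
    ∀ 𝔮 : PrimeSpectrum Λ, 𝔮.asIdeal.height = 1 → Module.lengthAt Λ M 𝔮 = Module.lengthAt Λ N 𝔮

open Literature.NumberTheory.ComplexMultiplication.EllipticUnits.JohnsonLeungKings2011 in
/-- **B2.** On ONE `ZetaSkeleton`, the char-ideal form of JLK Thm. 5.2 implies the regular-prime length form
(even without the restriction `p ∉ 𝔮`), given B1's finiteness/torsion side conditions. -/
def Thm57RegularOfThm52Char : Prop :=
  ∀ (Λ : Type u) [CommRing Λ] [IsDomain Λ] [IsNoetherianRing Λ] (A H0 H1 H2 : Type u)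
    [AddCommGroup H0] [Module Λ H0] [AddCommGroup H1] [Module Λ H1] [Module.Finite Λ H1]
    [AddCommGroup H2] [Module Λ H2] [Module.Finite Λ H2] (D : ZetaSkeleton Λ A H0 H1 H2),
    Module.IsTorsion Λ (H1 ⧸ D.Z) → Module.IsTorsion Λ H2 →
    (Module.heightOneSupport Λ (H1 ⧸ D.Z)).Finite → (Module.heightOneSupport Λ H2).Finite →
    D.Thm52CharShape → ∀ p : ℕ, D.Thm57RegularShape p

end Summit.BirchSwinnertonDyer.BirchSwinnertonDyer.Cruxes.ResidualThetaCountLowerPureAtTwo.StubIdeasK2G3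

end
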